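import Mathlib
import HarnessLib

/-!
# Route `IntegerScrew` — definitions: the von Mangoldt COUPLING MATRIX `N_M` and the PER-WINDOW FLOOR
# `f_M(a)` of the intercept problem (PIVOT-LAW §13.1, §13.3, §13.10 (v))

PIVOT-LAW §13 (rh-explicit, A6-PIVOT theory; HOME/pivot/) studies the intercept energy of Suzuki's nested
screw matrices through the window identity LEMMA W, whose prime side is the COUPLING FORM
`B_M(c) = Σ_{m ≥ 1, n ≥ 1, mn ≤ M} Λ(n) n^{−1/2} c_{mn} c_m` of a real vector `c = (c_k)_{1 ≤ k ≤ M}` — in the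
tree as the double sum `∑ m ∈ Icc 1 M, ∑ n ∈ Icc 1 (M / m), Λ n / √n * (c (m * n) * c m)`
(`IntegerScrewVonMangoldtCoupling*.lean`: LEMMA N (i), PROP. N2, PROP. N4).  This file NAMES the two objects
that THEOREM N6₁ (PIVOT-LAW 13.45: `log M/f_M(log M + s) = log log M + O(log log log M)`) is about:

* `couplingMatrix M` — the symmetric matrix `N_M` on the states `{1, …, M}` (the subtype of `Finset.Icc 1 M`)
  with `(N_M)_{k,kn} = (N_M)_{kn,k} = Λ(n)/√n` and all other entries `0` (zero diagonal since `Λ(1) = 0`), so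
  that `cᵀN_Mc = 2B_M(c)` (PIVOT-LAW 13.1);
* `windowFloor M a` — the per-window floor `f_M(a) := inf { a‖c‖² − 2B_M(c) : c real, c_1 = 1 }`
  (PIVOT-LAW 13.3; for `a > ν_max(N_M)` the infimum is a minimum and equals `1/[(aI − N_M)⁻¹]₁₁`, 13.10 (v) —
  proved elsewhere from `IntegerScrewResolventVariational`), written directly on sequences `c : ℕ → ℝ` in the
  tree's double-sum vocabulary (only `c_1, …, c_M` enter).

Definitions only (total functions; `windowFloor` is the real `sInf`, with Mathlib's junk value `0` when the
set is not bounded below, i.e. when `a < ν_max(N_M)`).  Nothing here is progress on `ζ`: `N_M` is an RH-free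
arithmetic matrix.  References: PIVOT-LAW §13.1, §13.3, §13.10, §13.45 (rh-explicit A6-PIVOT); M. Suzuki,
J. Lond. Math. Soc. (2) 108 (2023) 1448–1487 [Suzuki2023] for the screw matrices whose intercept energy
`f_M` bounds (PIVOT-LAW THEOREM 8).
-/

noncomputable section

-- D-0017: `Summit.<S>.<S>.…` is the designed namespace of a single-problem summit.
set_option linter.dupNamespace false

namespace Summit.RiemannHypothesis.RiemannHypothesis.Theorems.IntegerScrew

open ArithmeticFunction Finset

/-- The von Mangoldt COUPLING MATRIX `N_M` on `{1, …, M}` (PIVOT-LAW 13.1): the entry at `(k, j)` is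
`Λ(j/k)/√(j/k)` if `k ∣ j`, `Λ(k/j)/√(k/j)` if `j ∣ k`, and `0` otherwise; symmetric, zero diagonal
(`Λ(1) = 0`), and `cᵀN_Mc = 2·Σ_{mn ≤ M} Λ(n) n^{−1/2} c_{mn} c_m`. -/
def couplingMatrix (M : ℕ) : Matrix ↥(Finset.Icc 1 M) ↥(Finset.Icc 1 M) ℝ :=
  Matrix.of fun k j =>
    if (k : ℕ) ∣ (j : ℕ) then (Λ ((j : ℕ) / (k : ℕ)) : ℝ) / Real.sqrt (((j : ℕ) / (k : ℕ) : ℕ) : ℝ)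
    else if (j : ℕ) ∣ (k : ℕ) then (Λ ((k : ℕ) / (j : ℕ)) : ℝ) / Real.sqrt (((k : ℕ) / (j : ℕ) : ℕ) : ℝ)
    else 0

/-- The WINDOW FORM `Q_a(c) = a‖c‖² − cᵀN_Mc = a·Σ_{k ≤ M} c_k² − 2·Σ_{m ≤ M} Σ_{n ≤ M/m} Λ(n) n^{−1/2} c_{mn} c_m`
of a real sequence `c` (only `c_1, …, c_M` enter), PIVOT-LAW 13.1. -/
def couplingWindowForm (M : ℕ) (a : ℝ) (c : ℕ → ℝ) : ℝ :=
  a * ∑ k ∈ Icc 1 M, c k ^ 2 -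
    2 * ∑ m ∈ Icc 1 M, ∑ n ∈ Icc 1 (M / m), (Λ n : ℝ) / Real.sqrt n * (c (m * n) * c m)

/-- The PER-WINDOW FLOOR `f_M(a) := inf { Q_a(c) : c real, c_1 = 1 }` (PIVOT-LAW 13.3); for `a > ν_max(N_M)` it
is attained and equals `1/[(aI − N_M)⁻¹]₁₁` (13.10 (v)).  As a total function: the real `sInf` (junk value
`0` if the window form is unbounded below on `{c_1 = 1}`). -/
def windowFloor (M : ℕ) (a : ℝ) : ℝ :=
  sInf {q : ℝ | ∃ c : ℕ → ℝ, c 1 = 1 ∧ couplingWindowForm M a c = q}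

end Summit.RiemannHypothesis.RiemannHypothesis.Theorems.IntegerScrew

end
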